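/-
Copyright: cell pub-rosobs (carver-g59). INSTRUMENT for engine 1's W(f) toy model — NOT a resolution theorem.
-/
import Literature.AlgebraicGeometry.Resolution.WeightedCentreGradedIsotropy
import Mathlib.RingTheory.MvPolynomial.WeightedHomogeneous
import Mathlib.RingTheory.MvPolynomial.Homogeneous
import HarnessLib

/-!
# Menu (i) weight bookkeeping for PROPOSITION F (THEOREM-LT §15; CARVER T71 (a), the "MvPolynomial weight bookkeeping")

Instrument — NOT a resolution theorem, NOT a statement about the invariant of [AbramovichTemkinWlodarczyk2024], NOT summit progress;
AI review weaker than expert review.  Engine 1's PROPOSITION F, menu (i): `N = f ⊔ W` with weights `1/p` on `f`, `1/(p+1)` on `W`, isotropies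
of degree `ρ₁ = 1/(p(p+1))`.  Scaling by `p(p+1)`: INTEGER weights `wt p = (f ↦ p+1, W ↦ p)`, `deg σ = 1`.  The engine's first two sentences
  "A `W`-slot admits no impure term (nothing lighter), so [without pure term] `X` fixes `W`.  A term `σ^s·m` on `f_i` has weight `1/p − sρ₁`,
   so `(s, j) ∈ {(1,1), (p+1,0)}`: `X(f) = f + σM(W) + σ^{p+1}b` with `M` linear and `b` constant"
are typed here for ANY graded ring endomorphism `Φ` of `k[f ⊔ W][σ]` in the tree's sense (`IsGradedHom (wt p) 1 Φ`, `WeightedCentreGradedIsotropy`):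
* monomial arithmetic: `weight_wt` (`weight d = p·deg d + deg_f d`), `eq_zero_of_isWeightedHomogeneous` (no monomial has a weight `n` with
  `n ≠ 0`, `n < p`), `eq_C_of_isWeightedHomogeneous_zero` (weight `0` ⇒ constant), `degree_eq_one_of_weight_eq` / `_succ` (weight `p` ⇒ `W`-linear,
  weight `p+1` ⇒ `f`-linear, `2 ≤ p`);
* `W`-slots: `coeff_map_W_eq_zero` (`σ^s`-parts vanish for `0 < s ≠ p`), `coeff_map_W_p` (the `σ^p`-part is the PURE constant `pureCoeff Φ (W_j) p`),
  `support_coeff_map_W_zero` (the `σ⁰`-part is `W`-linear), `map_W_eq_C_of_pureCoeff_eq_zero` ("no pure `W`-term ⇒ `Φ(W_j)` is `σ`-free and `W`-linear");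
* `f`-slots: `coeff_map_f_eq_zero` (`σ^s`-parts vanish for `1 < s ≠ p+1`), `coeff_map_f_succ` (the `σ^{p+1}`-part is the constant `b_i`),
  `support_coeff_map_f_one` (the `σ¹`-part `M_i` is `W`-linear), `support_coeff_map_f_zero` (the `σ⁰`-part is `f`-linear), and the SHAPE
  `map_f_eq`: `Φ(f_i) = C P₀ + σ·C M_i + σ^{p+1}·C (C b_i)` — literally the substitution of `WeightedCentreTaylorLayers.shiftF p x ℓ d` (`x := P₀`,
  `ℓ := M_i`, `d := C b_i`), whose consequence `F(x + sℓ) = F(x)` is `TaylorLayers.taylorLine_eq_C_of_shiftF_eq_C` (PROP F (i) analytic step).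
NOT here: the unipotent normalisation `P₀ = f_i` / `Φ(W_j).coeff 0 = W_j` (part of the MODEL's "isotropy of degree `ρ₁`", LEMMA F0 (c)), "`g = F(f) + Q(W)`
has no mixed monomial" (the same arithmetic on `g`'s support; not needed by the typed steps), menu (ii), and the (P)-contradiction (T67, `InvariantDirection`).

v2 (section `Face`; the decls above it are unchanged) — "`g = F(f) + Q(W)`" on menu (i): `pure_of_weight_eq_mul` / `pure_of_mem_support` (a monomial of weight `p(p+1)` is
pure-`f` of degree `p` or pure-`W` of degree `p+1` — the engine's "a mixed monomial `f^kW^j`, `0 < k < p`, would need `k(p+1) = p(p+1−j)`, i.e. `p ∣ k`"), the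
decomposition `fPart g + wPart g = g` (`coeff_fPart/_wPart`, `isWeightedHomogeneous_fPart/_wPart`), **`isHomogeneous_fPart`** (`F(f)` is homogeneous of degree `p` —
the hypothesis of `WeightedCentreTaylorLayers.taylorLine_eq_C_of_shiftF_eq_C`) and **`support_wPart`** (`Q(W)` is `f`-free of degree `p+1`); section `Join`:
`map_C_eq_aeval` (`Φ(C g) = aeval (x ↦ Φ(C x)) g`, so `Φ(C g)` IS `shiftF`'s `aeval`) and `map_W_eq_of_pureCoeff_eq_zero` ("so `X` fixes `W`" under the unipotent normalisation `[σ⁰]Φ(W_j) = W_j`).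

References: gradings of weighted blow-ups [cite: AbramovichTemkinWlodarczyk2024, Thm. 5.3.1 (2)–(3) (p. 1578)]; weighted-homogeneous polynomials
[cite: Lang2002, Ch. IV §1]; the statements are engine 1's bookkeeping, the formalisation ours.
-/

open Polynomial

namespace Literature.AlgebraicGeometry.Resolution.WeightedBlowup

namespace MenuOne

variable {k : Type*} [CommRing k] {F W : Type*}

/-- Menu (i) weights scaled to integers: `f ↦ p+1`, `W ↦ p` (`σ ↦ 1`) (ours). [cite: AbramovichTemkinWlodarczyk2024, Thm. 5.3.1 (2)–(3) (p. 1578)] -/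
def wt (p : ℕ) : F ⊕ W → ℤ := Sum.elim (fun _ => (p : ℤ) + 1) (fun _ => (p : ℤ))

/-- (bookkeeping) [cite: Lang2002, Ch. IV §1] -/
@[simp] theorem wt_inl (p : ℕ) (i : F) : wt p (Sum.inl i : F ⊕ W) = p + 1 := rfl
/-- (bookkeeping) [cite: Lang2002, Ch. IV §1] -/
@[simp] theorem wt_inr (p : ℕ) (j : W) : wt p (Sum.inr j : F ⊕ W) = p := rfl

/-- Indicator of the `f`-slots (bookkeeping). [cite: Lang2002, Ch. IV §1] -/
def chiF : F ⊕ W → ℕ := Sum.elim (fun _ => 1) (fun _ => 0)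

/-- (bookkeeping) [cite: Lang2002, Ch. IV §1] -/
@[simp] theorem chiF_inl (i : F) : chiF (Sum.inl i : F ⊕ W) = 1 := rfl
/-- (bookkeeping) [cite: Lang2002, Ch. IV §1] -/
@[simp] theorem chiF_inr (j : W) : chiF (Sum.inr j : F ⊕ W) = 0 := rfl

/-- (bookkeeping) [cite: Lang2002, Ch. IV §1] -/
theorem chiF_le_one (x : F ⊕ W) : chiF x ≤ 1 := by cases x <;> simp

/-- The `f`-degree of a monomial: `Σ_{f-slots} d` (bookkeeping). [cite: Lang2002, Ch. IV §1] -/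
def degF (d : F ⊕ W →₀ ℕ) : ℕ := ∑ x ∈ d.support, chiF x * d x

/-- `deg_f d ≤ deg d` (bookkeeping). [cite: Lang2002, Ch. IV §1] -/
theorem degF_le_degree (d : F ⊕ W →₀ ℕ) : degF d ≤ d.degree := by
  rw [degF, Finsupp.degree_apply]
  exact Finset.sum_le_sum fun x _ => by
    calc chiF x * d x ≤ 1 * d x := Nat.mul_le_mul_right _ (chiF_le_one x)
      _ = d x := one_mul _

/-- `weight d = p · deg d + deg_f d` for the menu-(i) weights (ours). [cite: Lang2002, Ch. IV §1] -/
theorem weight_wt (p : ℕ) (d : F ⊕ W →₀ ℕ) :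
    Finsupp.weight (wt p) d = (p : ℤ) * (d.degree : ℤ) + (degF d : ℤ) := by
  rw [Finsupp.weight_apply, Finsupp.sum, Finsupp.degree_apply, degF]
  push_cast
  rw [Finset.mul_sum, ← Finset.sum_add_distrib]
  refine Finset.sum_congr rfl fun x _ => ?_
  rcases x with i | j <;> simp <;> ring

/-- A nonzero monomial has positive degree (bookkeeping). [cite: Lang2002, Ch. IV §1] -/
theorem degree_pos_of_ne_zero {d : F ⊕ W →₀ ℕ} (hd : d ≠ 0) : 0 < d.degree := by
  rw [Finsupp.degree_apply]
  obtain ⟨x, hx⟩ := Finsupp.ne_iff.mp hd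
  have hx' : x ∈ d.support := Finsupp.mem_support_iff.mpr (by simpa using hx)
  exact lt_of_lt_of_le (Nat.pos_of_ne_zero (by simpa using hx)) (Finset.single_le_sum (fun _ _ => Nat.zero_le _) hx')

/-- `p ≤ weight d` for every nonzero monomial (ours). [cite: Lang2002, Ch. IV §1] -/
theorem le_weight_of_ne_zero (p : ℕ) {d : F ⊕ W →₀ ℕ} (hd : d ≠ 0) : (p : ℤ) ≤ Finsupp.weight (wt p) d := by
  rw [weight_wt]
  have h1 : (1 : ℤ) ≤ (d.degree : ℤ) := by exact_mod_cast degree_pos_of_ne_zero hd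
  have h2 : (0 : ℤ) ≤ (degF d : ℤ) := by positivity
  nlinarith

/-- **No monomial has a weight `n` with `n ≠ 0`, `n < p`**: a weighted-homogeneous polynomial of such a weight is `0` (the engine's "carry no
monomial"; ours). [cite: Lang2002, Ch. IV §1] -/
theorem eq_zero_of_isWeightedHomogeneous (p : ℕ) {P : MvPolynomial (F ⊕ W) k} {n : ℤ}
    (hP : MvPolynomial.IsWeightedHomogeneous (wt p) P n) (hn0 : n ≠ 0) (hnp : n < p) : P = 0 := by
  ext d
  rw [MvPolynomial.coeff_zero]
  by_contra hc
  have hw := hP hc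
  by_cases hd : d = 0
  · subst hd
    simp at hw
    exact hn0 hw.symm
  · have := le_weight_of_ne_zero p hd
    rw [hw] at this
    exact absurd hnp (not_lt.mpr this)

/-- Weight `0` ⇒ constant (for `0 < p`; ours). [cite: Lang2002, Ch. IV §1] -/
theorem eq_C_of_isWeightedHomogeneous_zero {p : ℕ} (hp : 0 < p) {P : MvPolynomial (F ⊕ W) k}
    (hP : MvPolynomial.IsWeightedHomogeneous (wt p) P 0) : P = MvPolynomial.C (P.coeff 0) := by
  classical
  ext d
  rw [MvPolynomial.coeff_C]
  split_ifs with hd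
  · rw [← hd]
  · by_contra hc
    have hw := hP hc
    have := le_weight_of_ne_zero p (Ne.symm hd)
    rw [hw] at this
    exact absurd this (by exact_mod_cast Nat.not_le.mpr hp)

/-- Weight `p` ⇒ `W`-LINEAR: degree `1` and no `f`-slot (`0 < p`; ours). [cite: Lang2002, Ch. IV §1] -/
theorem degree_eq_one_of_weight_eq {p : ℕ} (hp : 0 < p) {d : F ⊕ W →₀ ℕ} (hw : Finsupp.weight (wt p) d = p) :
    d.degree = 1 ∧ ∀ i : F, d (Sum.inl i) = 0 := by
  rw [weight_wt] at hw
  have hle := degF_le_degree d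
  have hdeg : d.degree = 1 ∧ degF d = 0 := by
    rcases Nat.lt_or_ge d.degree 2 with h2 | h2
    · obtain h | h : d.degree = 0 ∨ d.degree = 1 := by omega
      · have : degF d = 0 := by omega
        rw [h, this] at hw
        simp at hw
        omega
      · refine ⟨h, ?_⟩
        rw [h] at hw
        have : (degF d : ℤ) = 0 := by push_cast at hw; linarith
        exact_mod_cast this
    · exfalso
      have : (2 : ℤ) ≤ (d.degree : ℤ) := by exact_mod_cast h2
      have h0 : (0 : ℤ) ≤ (degF d : ℤ) := by positivity
      have hp' : (1 : ℤ) ≤ p := by exact_mod_cast hp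
      nlinarith
  refine ⟨hdeg.1, fun i => ?_⟩
  by_contra hi
  have hmem : Sum.inl i ∈ d.support := Finsupp.mem_support_iff.mpr hi
  have : chiF (Sum.inl i : F ⊕ W) * d (Sum.inl i) ≤ degF d :=
    Finset.single_le_sum (f := fun x => chiF x * d x) (fun _ _ => Nat.zero_le _) hmem
  simp at this
  omega

/-- Weight `p+1` ⇒ `f`-LINEAR: degree `1` and no `W`-slot (`2 ≤ p`; ours). [cite: Lang2002, Ch. IV §1] -/
theorem degree_eq_one_of_weight_eq_succ {p : ℕ} (hp : 2 ≤ p) {d : F ⊕ W →₀ ℕ} (hw : Finsupp.weight (wt p) d = p + 1) :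
    d.degree = 1 ∧ ∀ j : W, d (Sum.inr j) = 0 := by
  rw [weight_wt] at hw
  have hle := degF_le_degree d
  have hdeg : d.degree = 1 ∧ degF d = 1 := by
    rcases Nat.lt_or_ge d.degree 2 with h2 | h2
    · obtain h | h : d.degree = 0 ∨ d.degree = 1 := by omega
      · have : degF d = 0 := by omega
        rw [h, this] at hw
        simp at hw
        omega
      · refine ⟨h, ?_⟩
        rw [h] at hw
        have : (degF d : ℤ) = 1 := by push_cast at hw; linarith
        exact_mod_cast this
    · exfalso
      have : (2 : ℤ) ≤ (d.degree : ℤ) := by exact_mod_cast h2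
      have h0 : (0 : ℤ) ≤ (degF d : ℤ) := by positivity
      have hp' : (2 : ℤ) ≤ p := by exact_mod_cast hp
      nlinarith
  refine ⟨hdeg.1, fun j => ?_⟩
  by_contra hj
  have hmem : Sum.inr j ∈ d.support := Finsupp.mem_support_iff.mpr hj
  -- `deg d - degF d = Σ (1 - χ_f) d ≥ d (inr j) ≥ 1`, but `deg d = degF d = 1`
  have hsum : d.degree = degF d + ∑ x ∈ d.support, (1 - chiF x) * d x := by
    rw [Finsupp.degree_apply, degF, ← Finset.sum_add_distrib]
    refine Finset.sum_congr rfl fun x _ => ?_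
    rcases x with i | j' <;> simp
  have : (1 - chiF (Sum.inr j : F ⊕ W)) * d (Sum.inr j) ≤ ∑ x ∈ d.support, (1 - chiF x) * d x :=
    Finset.single_le_sum (f := fun x => (1 - chiF x) * d x) (fun _ _ => Nat.zero_le _) hmem
  simp at this
  omega

/-! ## Consequences for a graded endomorphism `Φ` of `k[f ⊔ W][σ]` (`IsGradedHom (wt p) 1 Φ`) -/

variable {p : ℕ} {Φ : (MvPolynomial (F ⊕ W) k)[X] →+* (MvPolynomial (F ⊕ W) k)[X]}

/-- The `σ^s`-part of `Φ(x)` is weighted homogeneous of weight `wt x − s` (the tree's `IsTW`, unfolded; bookkeeping).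
[cite: AbramovichTemkinWlodarczyk2024, Thm. 5.3.1 (2)–(3) (p. 1578)] -/
theorem isWeightedHomogeneous_coeff_map (hΦ : IsGradedHom (wt p) 1 Φ) (x : F ⊕ W) (s : ℕ) :
    MvPolynomial.IsWeightedHomogeneous (wt p) ((Φ (C (MvPolynomial.X x))).coeff s) (wt p x - s) := by
  simpa using hΦ.isTW_CX x s

/-- **A `W`-slot admits no impure term**: the `σ^s`-parts of `Φ(W_j)` vanish for `0 < s ≠ p` (ours).
[cite: AbramovichTemkinWlodarczyk2024, Thm. 5.3.1 (2)–(3) (p. 1578)] -/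
theorem coeff_map_W_eq_zero (hΦ : IsGradedHom (wt p) 1 Φ) (j : W) {s : ℕ} (h0 : 0 < s) (hs : s ≠ p) :
    (Φ (C (MvPolynomial.X (Sum.inr j)))).coeff s = 0 :=
  eq_zero_of_isWeightedHomogeneous p (isWeightedHomogeneous_coeff_map hΦ _ s) (by simp; omega) (by simp; omega)

/-- The `σ^p`-part of `Φ(W_j)` is the PURE constant `pureCoeff Φ (W_j) p` (ours). [cite: AbramovichTemkinWlodarczyk2024, Thm. 5.3.1 (2)–(3) (p. 1578)] -/
theorem coeff_map_W_p (hΦ : IsGradedHom (wt p) 1 Φ) (hp : 0 < p) (j : W) :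
    (Φ (C (MvPolynomial.X (Sum.inr j)))).coeff p = MvPolynomial.C (pureCoeff Φ (Sum.inr j) p) := by
  have h := isWeightedHomogeneous_coeff_map hΦ (Sum.inr j) p
  simp only [wt_inr, sub_self] at h
  exact eq_C_of_isWeightedHomogeneous_zero hp h

/-- The `σ⁰`-part of `Φ(W_j)` is `W`-linear (ours). [cite: AbramovichTemkinWlodarczyk2024, Thm. 5.3.1 (2)–(3) (p. 1578)] -/
theorem support_coeff_map_W_zero (hΦ : IsGradedHom (wt p) 1 Φ) (hp : 0 < p) (j : W)
    {d : F ⊕ W →₀ ℕ} (hd : d ∈ ((Φ (C (MvPolynomial.X (Sum.inr j)))).coeff 0).support) :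
    d.degree = 1 ∧ ∀ i : F, d (Sum.inl i) = 0 := by
  have h := isWeightedHomogeneous_coeff_map hΦ (Sum.inr j) 0
  simp only [wt_inr, Nat.cast_zero, sub_zero] at h
  exact degree_eq_one_of_weight_eq hp (h (MvPolynomial.mem_support_iff.mp hd))

/-- **No pure `W`-term ⇒ `Φ(W_j)` is `σ`-free** (and `W`-linear by `support_coeff_map_W_zero`): PROP F's "so `X` fixes `W`" up to the linear part
(ours). [cite: AbramovichTemkinWlodarczyk2024, Thm. 5.3.1 (2)–(3) (p. 1578)] -/
theorem map_W_eq_C_of_pureCoeff_eq_zero (hΦ : IsGradedHom (wt p) 1 Φ) (hp : 0 < p) (j : W)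
    (hpure : pureCoeff Φ (Sum.inr j) p = 0) :
    Φ (C (MvPolynomial.X (Sum.inr j))) = C ((Φ (C (MvPolynomial.X (Sum.inr j)))).coeff 0) := by
  refine Polynomial.ext fun s => ?_
  rw [Polynomial.coeff_C]
  split_ifs with hs
  · rw [hs]
  · by_cases hsp : s = p
    · rw [hsp, coeff_map_W_p hΦ hp j, hpure, MvPolynomial.C_0]
    · exact coeff_map_W_eq_zero hΦ j (Nat.pos_of_ne_zero hs) hsp

/-- The `σ^s`-parts of `Φ(f_i)` vanish for `1 < s ≠ p+1` (the engine's "`(s, j) ∈ {(1,1), (p+1,0)}`"; ours).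
[cite: AbramovichTemkinWlodarczyk2024, Thm. 5.3.1 (2)–(3) (p. 1578)] -/
theorem coeff_map_f_eq_zero (hΦ : IsGradedHom (wt p) 1 Φ) (i : F) {s : ℕ} (h1 : 1 < s) (hs : s ≠ p + 1) :
    (Φ (C (MvPolynomial.X (Sum.inl i)))).coeff s = 0 :=
  eq_zero_of_isWeightedHomogeneous p (isWeightedHomogeneous_coeff_map hΦ _ s) (by simp; omega) (by simp; omega)

/-- The `σ^{p+1}`-part of `Φ(f_i)` is the constant `b_i = pureCoeff Φ (f_i) (p+1)` (ours). [cite: AbramovichTemkinWlodarczyk2024, Thm. 5.3.1 (2)–(3) (p. 1578)] -/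
theorem coeff_map_f_succ (hΦ : IsGradedHom (wt p) 1 Φ) (hp : 0 < p) (i : F) :
    (Φ (C (MvPolynomial.X (Sum.inl i)))).coeff (p + 1) = MvPolynomial.C (pureCoeff Φ (Sum.inl i) (p + 1)) := by
  have h := isWeightedHomogeneous_coeff_map hΦ (Sum.inl i) (p + 1)
  simp only [wt_inl, Nat.cast_add, Nat.cast_one, sub_self] at h
  exact eq_C_of_isWeightedHomogeneous_zero hp h

/-- The `σ¹`-part `M_i` of `Φ(f_i)` is `W`-LINEAR ("`σM(W)` with `M` a vector of linear forms"; ours).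
[cite: AbramovichTemkinWlodarczyk2024, Thm. 5.3.1 (2)–(3) (p. 1578)] -/
theorem support_coeff_map_f_one (hΦ : IsGradedHom (wt p) 1 Φ) (hp : 0 < p) (i : F)
    {d : F ⊕ W →₀ ℕ} (hd : d ∈ ((Φ (C (MvPolynomial.X (Sum.inl i)))).coeff 1).support) :
    d.degree = 1 ∧ ∀ i' : F, d (Sum.inl i') = 0 := by
  have h := isWeightedHomogeneous_coeff_map hΦ (Sum.inl i) 1
  simp only [wt_inl, Nat.cast_one, add_sub_cancel_right] at h
  exact degree_eq_one_of_weight_eq hp (h (MvPolynomial.mem_support_iff.mp hd))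

/-- The `σ⁰`-part of `Φ(f_i)` is `f`-LINEAR (`2 ≤ p`; ours). [cite: AbramovichTemkinWlodarczyk2024, Thm. 5.3.1 (2)–(3) (p. 1578)] -/
theorem support_coeff_map_f_zero (hΦ : IsGradedHom (wt p) 1 Φ) (hp : 2 ≤ p) (i : F)
    {d : F ⊕ W →₀ ℕ} (hd : d ∈ ((Φ (C (MvPolynomial.X (Sum.inl i)))).coeff 0).support) :
    d.degree = 1 ∧ ∀ j : W, d (Sum.inr j) = 0 := by
  have h := isWeightedHomogeneous_coeff_map hΦ (Sum.inl i) 0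
  simp only [wt_inl, Nat.cast_zero, sub_zero] at h
  exact degree_eq_one_of_weight_eq_succ hp (h (MvPolynomial.mem_support_iff.mp hd))

/-- **THE SHAPE `X(f) = P₀ + σM(W) + σ^{p+1}b`** (PROP F: "Hence `X(f) = f + σM(W) + σ^{p+1}b`", up to the normalisation `P₀ = f`): for a graded `Φ`,
`Φ(f_i) = C P₀ + σ·C M_i + σ^{p+1}·C (C b_i)` with `P₀ = [σ⁰]Φ(f_i)`, `M_i = [σ¹]Φ(f_i)`, `b_i = pureCoeff Φ (f_i) (p+1)` — the substitution of
`WeightedCentreTaylorLayers.shiftF p x ℓ d` (`0 < p`; ours). [cite: AbramovichTemkinWlodarczyk2024, Thm. 5.3.1 (2)–(3) (p. 1578)] -/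
theorem map_f_eq (hΦ : IsGradedHom (wt p) 1 Φ) (hp : 0 < p) (i : F) :
    Φ (C (MvPolynomial.X (Sum.inl i))) =
      C ((Φ (C (MvPolynomial.X (Sum.inl i)))).coeff 0) + X * C ((Φ (C (MvPolynomial.X (Sum.inl i)))).coeff 1)
        + X ^ (p + 1) * C (MvPolynomial.C (pureCoeff Φ (Sum.inl i) (p + 1))) := by
  rw [Polynomial.X_mul_C, Polynomial.X_pow_mul_C]
  refine Polynomial.ext fun s => ?_
  simp only [Polynomial.coeff_add, Polynomial.coeff_C, Polynomial.coeff_C_mul_X, Polynomial.coeff_C_mul_X_pow]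
  by_cases h0 : s = 0
  · subst h0
    rw [if_pos rfl, if_neg (by omega), if_neg (by omega), add_zero, add_zero]
  by_cases h1 : s = 1
  · subst h1
    rw [if_neg (by omega), if_pos rfl, if_neg (by omega), zero_add, add_zero]
  by_cases hsp : s = p + 1
  · subst hsp
    rw [if_neg h0, if_neg h1, if_pos rfl, coeff_map_f_succ hΦ hp i, zero_add, zero_add]
  · rw [if_neg h0, if_neg h1, if_neg hsp, add_zero, add_zero]
    exact coeff_map_f_eq_zero hΦ i (by omega) hsp

/-! ## "`g = F(f) + Q(W)`": a monomial of weight `p(p+1)` is pure-`f` of degree `p` or pure-`W` of degree `p+1` (v2) -/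

section Face

omit [CommRing k] in
/-- `deg_f d = 0` ⇒ no `f`-slot (bookkeeping). [cite: Lang2002, Ch. IV §1] -/
theorem apply_inl_eq_zero_of_degF_eq_zero {d : F ⊕ W →₀ ℕ} (h : degF d = 0) (i : F) : d (Sum.inl i) = 0 := by
  by_contra hi
  have hmem : Sum.inl i ∈ d.support := Finsupp.mem_support_iff.mpr hi
  have : chiF (Sum.inl i : F ⊕ W) * d (Sum.inl i) ≤ degF d :=
    Finset.single_le_sum (f := fun x => chiF x * d x) (fun _ _ => Nat.zero_le _) hmem
  simp at this
  omega

omit [CommRing k] in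
/-- `deg_f d = deg d` ⇒ no `W`-slot (bookkeeping). [cite: Lang2002, Ch. IV §1] -/
theorem apply_inr_eq_zero_of_degF_eq_degree {d : F ⊕ W →₀ ℕ} (h : degF d = d.degree) (j : W) : d (Sum.inr j) = 0 := by
  by_contra hj
  have hmem : Sum.inr j ∈ d.support := Finsupp.mem_support_iff.mpr hj
  have hsum : d.degree = degF d + ∑ x ∈ d.support, (1 - chiF x) * d x := by
    rw [Finsupp.degree_apply, degF, ← Finset.sum_add_distrib]
    refine Finset.sum_congr rfl fun x _ => ?_
    rcases x with i | j' <;> simp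
  have : (1 - chiF (Sum.inr j : F ⊕ W)) * d (Sum.inr j) ≤ ∑ x ∈ d.support, (1 - chiF x) * d x :=
    Finset.single_le_sum (f := fun x => (1 - chiF x) * d x) (fun _ _ => Nat.zero_le _) hmem
  simp at this
  omega

omit [CommRing k] in
/-- **Weight `p(p+1)` ⇒ PURE**: a monomial of the face's weight is a pure `f`-monomial of degree `p` or a pure `W`-monomial of degree `p+1` (the engine's
"a mixed monomial `f^k W^j`, `0 < k < p`, would need `k(p+1) = p(p+1−j)`, i.e. `p ∣ k`"; `0 < p`; ours). [cite: Lang2002, Ch. IV §1] -/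
theorem pure_of_weight_eq_mul {p : ℕ} (hp : 0 < p) {d : F ⊕ W →₀ ℕ} (hw : Finsupp.weight (wt p) d = (p : ℤ) * (p + 1)) :
    (d.degree = p ∧ ∀ j : W, d (Sum.inr j) = 0) ∨ (d.degree = p + 1 ∧ ∀ i : F, d (Sum.inl i) = 0) := by
  rw [weight_wt] at hw
  have hle : (degF d : ℤ) ≤ d.degree := by exact_mod_cast degF_le_degree d
  have h0 : (0 : ℤ) ≤ degF d := by positivity
  have hp' : (0 : ℤ) < p := by exact_mod_cast hp
  -- `p ≤ deg ≤ p + 1`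
  have hD1 : (d.degree : ℤ) ≤ p + 1 := by nlinarith
  have hD2 : (p : ℤ) ≤ d.degree := by nlinarith
  rcases eq_or_lt_of_le hD2 with hD | hD
  · left
    have hdeg : d.degree = p := by exact_mod_cast hD.symm
    refine ⟨hdeg, apply_inr_eq_zero_of_degF_eq_degree ?_⟩
    have : (degF d : ℤ) = d.degree := by rw [← hD] at hw ⊢; nlinarith
    exact_mod_cast this
  · right
    have hdeg : (d.degree : ℤ) = p + 1 := le_antisymm hD1 (by omega)
    refine ⟨by exact_mod_cast hdeg, apply_inl_eq_zero_of_degF_eq_zero ?_⟩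
    have : (degF d : ℤ) = 0 := by rw [hdeg] at hw; nlinarith
    exact_mod_cast this

/-- **"`g = F(f) + Q(W)`" on menu (i)** (PROP F: no mixed monomial in a face of weight `p(p+1)`; ours): every monomial of a weighted-homogeneous `g` of
weight `p(p+1)` is pure-`f` of degree `p` or pure-`W` of degree `p+1`. [cite: AbramovichTemkinWlodarczyk2024, Thm. 5.3.1 (2)–(3) (p. 1578)] -/
theorem pure_of_mem_support {p : ℕ} (hp : 0 < p) {g : MvPolynomial (F ⊕ W) k}
    (hg : MvPolynomial.IsWeightedHomogeneous (wt p) g ((p : ℤ) * (p + 1))) {d : F ⊕ W →₀ ℕ} (hd : d ∈ g.support) :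
    (d.degree = p ∧ ∀ j : W, d (Sum.inr j) = 0) ∨ (d.degree = p + 1 ∧ ∀ i : F, d (Sum.inl i) = 0) :=
  pure_of_weight_eq_mul hp (hg (MvPolynomial.mem_support_iff.mp hd))

omit [CommRing k] in
/-- No `f`-slot ⇒ `deg_f = 0` (bookkeeping). [cite: Lang2002, Ch. IV §1] -/
theorem degF_eq_zero_of_apply_inl {d : F ⊕ W →₀ ℕ} (h : ∀ i : F, d (Sum.inl i) = 0) : degF d = 0 :=
  Finset.sum_eq_zero fun x _ => by rcases x with i | j <;> simp [h]

omit [CommRing k] in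
/-- No `W`-slot ⇒ `deg_f = deg` (bookkeeping). [cite: Lang2002, Ch. IV §1] -/
theorem degF_eq_degree_of_apply_inr {d : F ⊕ W →₀ ℕ} (h : ∀ j : W, d (Sum.inr j) = 0) : degF d = d.degree := by
  rw [degF, Finsupp.degree_apply]
  exact Finset.sum_congr rfl fun x _ => by rcases x with i | j <;> simp [h]

/-- The `f`-PART `F(f)` of `g`: its monomials without `W`-slot (`deg_f = deg`; bookkeeping). [cite: Lang2002, Ch. IV §1] -/
noncomputable def fPart (g : MvPolynomial (F ⊕ W) k) : MvPolynomial (F ⊕ W) k :=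
  ∑ d ∈ g.support with degF d = d.degree, MvPolynomial.monomial d (g.coeff d)

/-- The complementary part of `g` (on a menu-(i) face: the `W`-part `Q(W)`; bookkeeping). [cite: Lang2002, Ch. IV §1] -/
noncomputable def wPart (g : MvPolynomial (F ⊕ W) k) : MvPolynomial (F ⊕ W) k :=
  ∑ d ∈ g.support with ¬ degF d = d.degree, MvPolynomial.monomial d (g.coeff d)

/-- `g = fPart g + wPart g` (bookkeeping). [cite: Lang2002, Ch. IV §1] -/
theorem fPart_add_wPart (g : MvPolynomial (F ⊕ W) k) : fPart g + wPart g = g := by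
  rw [fPart, wPart, Finset.sum_filter_add_sum_filter_not]
  exact (MvPolynomial.as_sum g).symm

/-- Coefficients of the `f`-part (bookkeeping). [cite: Lang2002, Ch. IV §1] -/
theorem coeff_fPart (g : MvPolynomial (F ⊕ W) k) (d : F ⊕ W →₀ ℕ) :
    (fPart g).coeff d = if degF d = d.degree then g.coeff d else 0 := by
  classical
  rw [fPart, MvPolynomial.coeff_sum]
  simp only [MvPolynomial.coeff_monomial]
  rw [Finset.sum_ite_eq']
  by_cases hd : d ∈ g.support
  · simp [Finset.mem_filter, hd]
  · have h0 : g.coeff d = 0 := by simpa [MvPolynomial.mem_support_iff] using hd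
    simp [Finset.mem_filter, hd, h0]

/-- Coefficients of the complementary part (bookkeeping). [cite: Lang2002, Ch. IV §1] -/
theorem coeff_wPart (g : MvPolynomial (F ⊕ W) k) (d : F ⊕ W →₀ ℕ) :
    (wPart g).coeff d = if degF d = d.degree then 0 else g.coeff d := by
  classical
  rw [wPart, MvPolynomial.coeff_sum]
  simp only [MvPolynomial.coeff_monomial]
  rw [Finset.sum_ite_eq']
  by_cases hd : d ∈ g.support
  · by_cases h : degF d = d.degree <;> simp [Finset.mem_filter, hd, h]
  · have h0 : g.coeff d = 0 := by simpa [MvPolynomial.mem_support_iff] using hd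
    simp [Finset.mem_filter, hd, h0]

/-- Both parts of a weighted-homogeneous `g` are weighted-homogeneous of the same weight (bookkeeping). [cite: Lang2002, Ch. IV §1] -/
theorem isWeightedHomogeneous_fPart {p : ℕ} {g : MvPolynomial (F ⊕ W) k} {n : ℤ} (hg : MvPolynomial.IsWeightedHomogeneous (wt p) g n) :
    MvPolynomial.IsWeightedHomogeneous (wt p) (fPart g) n := fun d hd => by
  rw [coeff_fPart] at hd
  split_ifs at hd with h
  · exact hg hd
  · exact absurd rfl hd

/-- (idem for the complementary part). [cite: Lang2002, Ch. IV §1] -/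
theorem isWeightedHomogeneous_wPart {p : ℕ} {g : MvPolynomial (F ⊕ W) k} {n : ℤ} (hg : MvPolynomial.IsWeightedHomogeneous (wt p) g n) :
    MvPolynomial.IsWeightedHomogeneous (wt p) (wPart g) n := fun d hd => by
  rw [coeff_wPart] at hd
  split_ifs at hd with h
  · exact absurd rfl hd
  · exact hg hd

/-- **`F(f)` is homogeneous of degree `p`** on a menu-(i) face (the hypothesis of `WeightedCentreTaylorLayers.taylorLine_eq_C_of_shiftF_eq_C`; ours).
[cite: AbramovichTemkinWlodarczyk2024, Thm. 5.3.1 (2)–(3) (p. 1578)] -/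
theorem isHomogeneous_fPart {p : ℕ} (hp : 0 < p) {g : MvPolynomial (F ⊕ W) k}
    (hg : MvPolynomial.IsWeightedHomogeneous (wt p) g ((p : ℤ) * (p + 1))) : MvPolynomial.IsHomogeneous (fPart g) p := by
  rw [fPart]
  refine MvPolynomial.IsHomogeneous.sum _ _ _ fun d hd => MvPolynomial.isHomogeneous_monomial _ ?_
  rw [Finset.mem_filter] at hd
  rcases pure_of_mem_support hp hg hd.1 with ⟨hdeg, -⟩ | ⟨hdeg, hinl⟩
  · exact hdeg
  · exfalso
    rw [degF_eq_zero_of_apply_inl hinl, hdeg] at hd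
    omega

/-- **`Q(W)` is free of `f`** on a menu-(i) face: every monomial of the complementary part has no `f`-slot and degree `p+1` ("`g = F(f) + Q(W)`"; ours).
[cite: AbramovichTemkinWlodarczyk2024, Thm. 5.3.1 (2)–(3) (p. 1578)] -/
theorem support_wPart {p : ℕ} (hp : 0 < p) {g : MvPolynomial (F ⊕ W) k}
    (hg : MvPolynomial.IsWeightedHomogeneous (wt p) g ((p : ℤ) * (p + 1))) {d : F ⊕ W →₀ ℕ} (hd : d ∈ (wPart g).support) :
    d.degree = p + 1 ∧ ∀ i : F, d (Sum.inl i) = 0 := by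
  have hc := MvPolynomial.mem_support_iff.mp hd
  rw [coeff_wPart] at hc
  split_ifs at hc with h
  · exact absurd rfl hc
  · rcases pure_of_mem_support hp hg (MvPolynomial.mem_support_iff.mpr hc) with ⟨-, hinr⟩ | h2
    · exact absurd (degF_eq_degree_of_apply_inr hinr) h
    · exact h2

end Face

/-! ## Join helpers (v2): `Φ ∘ C` as a substitution; "`X` fixes `W`" under the unipotent normalisation -/

section Join

variable {p : ℕ} {Φ : (MvPolynomial (F ⊕ W) k)[X] →+* (MvPolynomial (F ⊕ W) k)[X]}

/-- `Φ(g) = g(Φ(f), Φ(W))`: on constants-in-`σ`, a graded `Φ` is the substitution of the images of the variables — so `Φ (C g)` is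
`WeightedCentreTaylorLayers.shiftF`'s `aeval` once `map_f_eq` / `map_W_eq_of_pureCoeff_eq_zero` are inserted (bookkeeping). [cite: AbramovichTemkinWlodarczyk2024, Thm. 5.3.1 (2)–(3) (p. 1578)] -/
theorem map_C_eq_aeval (hΦ : IsGradedHom (wt p) 1 Φ) (g : MvPolynomial (F ⊕ W) k) :
    Φ (C g) = MvPolynomial.aeval (fun x => Φ (C (MvPolynomial.X x))) g := by
  have key : Φ.comp C = (MvPolynomial.aeval (R := k) fun x => Φ (C (MvPolynomial.X x))).toRingHom := by
    refine MvPolynomial.ringHom_ext (fun c => ?_) (fun x => ?_)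
    · rw [RingHom.comp_apply, hΦ.map_C_C, AlgHom.toRingHom_eq_coe, RingHom.coe_coe, MvPolynomial.algHom_C, Polynomial.algebraMap_apply,
        MvPolynomial.algebraMap_eq]
    · rw [RingHom.comp_apply, AlgHom.toRingHom_eq_coe, RingHom.coe_coe, MvPolynomial.aeval_X]
  exact RingHom.congr_fun key g

/-- **"So `X` fixes `W`"** (PROP F): no pure `W`-term and the unipotent normalisation `[σ⁰]Φ(W_j) = W_j` (LEMMA F0 (c): isotropies of degree `ρ₁` are
`≡ id mod σ`) give `Φ(W_j) = W_j` (ours). [cite: AbramovichTemkinWlodarczyk2024, Thm. 5.3.1 (2)–(3) (p. 1578)] -/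
theorem map_W_eq_of_pureCoeff_eq_zero (hΦ : IsGradedHom (wt p) 1 Φ) (hp : 0 < p) (j : W) (hpure : pureCoeff Φ (Sum.inr j) p = 0)
    (hunip : (Φ (C (MvPolynomial.X (Sum.inr j)))).coeff 0 = MvPolynomial.X (Sum.inr j)) :
    Φ (C (MvPolynomial.X (Sum.inr j))) = C (MvPolynomial.X (Sum.inr j)) := by
  rw [map_W_eq_C_of_pureCoeff_eq_zero hΦ hp j hpure, hunip]

end Join

end MenuOne

end Literature.AlgebraicGeometry.Resolution.WeightedBlowup
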